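import Literature.NumberTheory.DiophantineGeometry.TateAlgorithmTranslationsProofs
import Literature.RingTheory.DiscreteValuationRing.AdicCompletionHensel
import HarnessLib

/-!
# A normal form for non-split multiplicative equations over a Henselian ring

Let `R` be a Henselian discrete valuation ring with perfect residue field `k` and `I` an
equation over `R` with multiplicative reduction (`Δ ∈ 𝔪`, `c₄ ∉ 𝔪`) which is *non-split*: the
node-tangent polynomial `c₄T² + a₁c₄T − (54b₆ − 3b₂b₄ + a₂c₄)` of Mathlib's
`WeierstrassCurve.HasSplitMultiplicativeReduction` has no root in `k`. Then an `R`-integral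
change of variables `D` gives `J = D • I : y² + a₁xy = x³ + a₂x² + a₆` with `a₃ = a₄ = 0`,
`a₆ ∈ 𝔪`, `b₂ ∈ Rˣ`, and the tangent form `T² + ā₁T − ā₂` at the node `(0, 0)` of the reduction
anisotropic over `k` (`exists_smul_nonsplitNormalForm`). This is the input of the computation of
`c_v ∈ {1, 2}` for non-split multiplicative reduction (Silverman, *ATAEC*, IV.9.4 Step 2,
PDF p. 344: "`c = 1` if `v(Δ)` odd, `c = 2` if `v(Δ)` even" when `T² + a₁T − a₂` does not split).

Steps: move the node to `(0, 0)` (Step 2, `exists_variableChange_step2_of_perfectField`), then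
kill `a₃` and `a₄` exactly by a change `⟨1, r, 0, t⟩` found by Hensel's lemma
(`HenselianLocalRing.exists_isRoot_of_isUnit_derivative`): if `2 ∈ Rˣ`, `t = −(a₃ + ra₁)/2` and
`r` is a root of `3r² + (2a₂ + a₁²/2)r + (a₄ + a₁a₃/2)` (derivative `≡ b₂/2`); otherwise `a₁ ∈ Rˣ`,
`r = −(a₃ + 2t)/a₁` and `t` is a root of a quadratic with derivative `≡ −b₂/a₁`. The tangent
form is controlled by the identity `P_{C • W}(T) = P_W(T + s)` for the node-tangent polynomial
`P` under a change with `u = 1` (`eval_nodePoly_smul`) and `P = c₄(T² + a₁T − a₂)` when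
`b₄ = b₆ = 0` — so a root of `T² + ā₁T − ā₂` for `J̄` would be a root of `P_Ī`.

## References

* J. H. Silverman, *Advanced Topics in the Arithmetic of Elliptic Curves*, GTM 151, Springer
  1994, IV.9.4 Step 2 (PDF p. 344) and its proof (PDF pp. 366–367). [SilvermanATAEC1994]
-/

noncomputable section

open scoped Classical

open IsLocalRing Polynomial

namespace Literature.NumberTheory.EllipticCurves

namespace LocalIndex

open DiophantineGeometry DiophantineGeometry.TateAlgorithm

/-! ### The node-tangent polynomial under a change of variables with `u = 1` -/

section NodePoly

variable {S : Type*} [CommRing S]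

/-- **`P_{C • W}(μ) = P_W(μ + s)`** for the node-tangent polynomial
`P_W(T) = c₄T² + a₁c₄T − (54b₆ − 3b₂b₄ + a₂c₄)` of Mathlib's `HasSplitMultiplicativeReduction`
and a change of variables `C = ⟨1, r, s, t⟩`: `c₄` is invariant, `54b₆ − 3b₂b₄` changes by
`−3rc₄`, `a₂c₄` by `(3r − sa₁ − s²)c₄`, and `a₁` by `2s`. [folklore] -/
theorem eval_nodePoly_smul (W : WeierstrassCurve S) (C : WeierstrassCurve.VariableChange S)
    (hu : C.u = 1) (μ : S) :
    (C • W).c₄ * μ ^ 2 + (C • W).a₁ * (C • W).c₄ * μ -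
        (54 * (C • W).b₆ - 3 * (C • W).b₂ * (C • W).b₄ + (C • W).a₂ * (C • W).c₄) =
      W.c₄ * (μ + C.s) ^ 2 + W.a₁ * W.c₄ * (μ + C.s) -
        (54 * W.b₆ - 3 * W.b₂ * W.b₄ + W.a₂ * W.c₄) := by
  have hc₄ : W.c₄ = W.b₂ ^ 2 - 24 * W.b₄ := rfl
  rw [WeierstrassCurve.variableChange_c₄, WeierstrassCurve.variableChange_a₁,
    WeierstrassCurve.variableChange_a₂, WeierstrassCurve.variableChange_b₂,
    WeierstrassCurve.variableChange_b₄, WeierstrassCurve.variableChange_b₆, hu, hc₄]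
  simp only [inv_one, Units.val_one, one_pow, one_mul]
  ring

/-- For an equation with `a₃ = a₄ = a₆ = 0` (singular point at the origin) the node-tangent
polynomial is `c₄(T² + a₁T − a₂)` with `c₄ = b₂²`. [folklore] -/
theorem eval_nodePoly_of_a₃₄₆ (W : WeierstrassCurve S) (h3 : W.a₃ = 0) (h4 : W.a₄ = 0)
    (h6 : W.a₆ = 0) (μ : S) :
    W.c₄ * μ ^ 2 + W.a₁ * W.c₄ * μ - (54 * W.b₆ - 3 * W.b₂ * W.b₄ + W.a₂ * W.c₄) =
      W.b₂ ^ 2 * (μ ^ 2 + W.a₁ * μ - W.a₂) := by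
  have hb₄ : W.b₄ = 0 := by rw [WeierstrassCurve.b₄, h3, h4]; ring
  have hb₆ : W.b₆ = 0 := by rw [WeierstrassCurve.b₆, h3, h6]; ring
  have hc₄ : W.c₄ = W.b₂ ^ 2 := by
    rw [show W.c₄ = W.b₂ ^ 2 - 24 * W.b₄ from rfl, hb₄]; ring
  rw [hb₄, hb₆, hc₄]; ring

end NodePoly

/-! ### Killing `a₃` and `a₄` by Hensel's lemma -/

variable {R : Type*} [CommRing R] [IsDomain R] [IsDiscreteValuationRing R]

/-- **Exact normalisation `a₃ = a₄ = 0` at a node.** Over a Henselian discrete valuation ring,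
if `a₃, a₄, a₆ ∈ 𝔪` and `b₂ ∈ Rˣ` (node at the origin of the reduction), there are `r, t ∈ 𝔪`
with `(⟨1, r, 0, t⟩ • W).a₃ = 0` and `(⟨1, r, 0, t⟩ • W).a₄ = 0`: the system
`a₃ + ra₁ + 2t = 0`, `a₄ + 2ra₂ − ta₁ + 3r² = 0` has Jacobian `−b₂` at the origin, and is solved
by eliminating `t` (if `2 ∈ Rˣ`) or `r` (if `a₁ ∈ Rˣ`; one of the two holds as `b₂ = a₁² + 4a₂`)
and applying Hensel's lemma to the remaining quadratic. [folklore] -/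
theorem exists_rt_a₃_a₄_eq_zero [HenselianLocalRing R] (W : WeierstrassCurve R)
    (h3 : W.a₃ ∈ maximalIdeal R) (h4 : W.a₄ ∈ maximalIdeal R) (hb₂ : IsUnit W.b₂) :
    ∃ r t : R, r ∈ maximalIdeal R ∧ t ∈ maximalIdeal R ∧
      ((⟨1, r, 0, t⟩ : WeierstrassCurve.VariableChange R) • W).a₃ = 0 ∧
      ((⟨1, r, 0, t⟩ : WeierstrassCurve.VariableChange R) • W).a₄ = 0 := by
  have e3 : ∀ r t : R, ((⟨1, r, 0, t⟩ : WeierstrassCurve.VariableChange R) • W).a₃ =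
      W.a₃ + r * W.a₁ + 2 * t := by
    intro r t; rw [WeierstrassCurve.variableChange_a₃]; simp
  have e4 : ∀ r t : R, ((⟨1, r, 0, t⟩ : WeierstrassCurve.VariableChange R) • W).a₄ =
      W.a₄ + 2 * r * W.a₂ - t * W.a₁ + 3 * r ^ 2 := by
    intro r t; rw [WeierstrassCurve.variableChange_a₄]; simp
  have hb₂def : W.b₂ = W.a₁ ^ 2 + 4 * W.a₂ := rfl
  by_cases h2 : IsUnit (2 : R)
  · -- eliminate `t = -(a₃ + r a₁)/2`
    set ι : R := ↑h2.unit⁻¹ with hι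
    have h2ι : 2 * ι = 1 := by rw [hι]; exact h2.mul_val_inv
    set β : R := 2 * W.a₂ + ι * W.a₁ ^ 2 with hβ
    set γ : R := W.a₄ + ι * W.a₁ * W.a₃ with hγ
    set G : R[X] := C 3 * X ^ 2 + C β * X + C γ with hG
    have hev : ∀ r, G.eval r = 3 * r ^ 2 + β * r + γ := by intro r; simp [hG]
    have hev' : ∀ r, G.derivative.eval r = 6 * r + β := by
      intro r
      simp only [hG, derivative_add, derivative_mul, derivative_C, zero_mul, derivative_X_pow,
        zero_add, derivative_X, mul_one, eval_add, eval_mul, eval_C, eval_X, eval_pow,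
        Nat.cast_ofNat, add_zero]
      ring
    have hG0 : G.eval 0 ∈ maximalIdeal R := by
      rw [hev, hγ]; simp only [ne_eq, zero_pow, OfNat.ofNat_ne_zero, not_false_eq_true,
        mul_zero, zero_add, add_zero]
      exact Ideal.add_mem _ h4 (Ideal.mul_mem_left _ _ h3)
    have hG1 : IsUnit (G.derivative.eval 0) := by
      rw [hev', mul_zero, zero_add, hβ]
      have e : 2 * (2 * W.a₂ + ι * W.a₁ ^ 2) = W.b₂ := by
        rw [hb₂def]; linear_combination W.a₁ ^ 2 * h2ι
      have hu : IsUnit (2 * (2 * W.a₂ + ι * W.a₁ ^ 2)) := by rw [e]; exact hb₂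
      exact isUnit_of_mul_isUnit_right hu
    obtain ⟨r, hr, hr0⟩ := HenselianLocalRing.exists_isRoot_of_isUnit_derivative G 0 hG0 hG1
    rw [sub_zero] at hr0
    refine ⟨r, -(W.a₃ + r * W.a₁) * ι, hr0, ?_, ?_, ?_⟩
    · exact Ideal.mul_mem_right _ _ ((maximalIdeal R).neg_mem
        (Ideal.add_mem _ h3 (Ideal.mul_mem_right _ _ hr0)))
    · rw [e3]; linear_combination (-(W.a₃ + r * W.a₁)) * h2ι
    · rw [e4]
      have := hr.eq_zero
      rw [hev, hβ, hγ] at this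
      linear_combination this
  · -- `2 ∈ 𝔪`, so `a₁ ∈ Rˣ`; eliminate `r = -(a₃ + 2t)/a₁`
    have h2m : (2 : R) ∈ maximalIdeal R := (IsLocalRing.mem_maximalIdeal _).mpr h2
    have ha₁ : IsUnit W.a₁ := by
      have hsq : IsUnit (W.a₁ ^ 2) := by
        refine IsLocalRing.notMem_maximalIdeal.mp fun hmem => ?_
        apply IsLocalRing.notMem_maximalIdeal.mpr hb₂
        rw [hb₂def, show (4 : R) = 2 * 2 by norm_num]
        exact Ideal.add_mem _ hmem (Ideal.mul_mem_right _ _ (Ideal.mul_mem_right _ _ h2m))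
      exact (isUnit_pow_iff two_ne_zero).mp hsq
    set κ : R := ↑ha₁.unit⁻¹ with hκ
    have hκ1 : W.a₁ * κ = 1 := by rw [hκ]; exact ha₁.mul_val_inv
    set β : R := -4 * κ * W.a₂ - W.a₁ + 12 * κ ^ 2 * W.a₃ with hβ
    set γ : R := W.a₄ - 2 * κ * W.a₂ * W.a₃ + 3 * κ ^ 2 * W.a₃ ^ 2 with hγ
    set G : R[X] := C (12 * κ ^ 2) * X ^ 2 + C β * X + C γ with hG
    have hev : ∀ t, G.eval t = 12 * κ ^ 2 * t ^ 2 + β * t + γ := by intro t; simp [hG]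
    have hev' : ∀ t, G.derivative.eval t = 2 * (12 * κ ^ 2) * t + β := by
      intro t
      simp only [hG, derivative_add, derivative_mul, derivative_C, zero_mul, derivative_X_pow,
        zero_add, derivative_X, mul_one, eval_add, eval_mul, eval_C, eval_X, eval_pow,
        Nat.cast_ofNat, add_zero]
      ring
    have hG0 : G.eval 0 ∈ maximalIdeal R := by
      rw [hev, hγ]; simp only [ne_eq, zero_pow, OfNat.ofNat_ne_zero, not_false_eq_true,
        mul_zero, zero_add, add_zero]
      refine Ideal.add_mem _ (Ideal.sub_mem _ h4 (Ideal.mul_mem_left _ _ h3)) ?_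
      exact Ideal.mul_mem_left _ _ (Ideal.pow_mem_of_mem _ h3 2 two_pos)
    have hG1 : IsUnit (G.derivative.eval 0) := by
      rw [hev', mul_zero, zero_add, hβ]
      have e : (-W.a₁) * (-4 * κ * W.a₂ - W.a₁ + 12 * κ ^ 2 * W.a₃) =
          W.b₂ + (-12 * κ * W.a₃) := by
        rw [hb₂def]; linear_combination (4 * W.a₂ - 12 * κ * W.a₃) * hκ1
      obtain ⟨c, hc⟩ := (mem_maximalIdeal_iff_dvd_of_irreducible irreducible_uniformizer _).mp h3
      have hu : IsUnit ((-W.a₁) * (-4 * κ * W.a₂ - W.a₁ + 12 * κ ^ 2 * W.a₃)) := by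
        rw [e, hc, show -12 * κ * (uniformizer R * c) = uniformizer R * (-12 * κ * c) by ring]
        exact isUnit_add_mul_of_isUnit irreducible_uniformizer hb₂ _
      exact isUnit_of_mul_isUnit_right hu
    obtain ⟨t, ht, ht0⟩ := HenselianLocalRing.exists_isRoot_of_isUnit_derivative G 0 hG0 hG1
    rw [sub_zero] at ht0
    refine ⟨-(W.a₃ + 2 * t) * κ, t, ?_, ht0, ?_, ?_⟩
    · exact Ideal.mul_mem_right _ _ ((maximalIdeal R).neg_mem
        (Ideal.add_mem _ h3 (Ideal.mul_mem_left _ _ ht0)))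
    · rw [e3]; linear_combination (-(W.a₃ + 2 * t)) * hκ1
    · rw [e4]
      have := ht.eq_zero
      rw [hev, hβ, hγ] at this
      linear_combination this

/-! ### The normal form -/

/-- **The normal form of a non-split multiplicative equation.** Over a Henselian discrete
valuation ring with perfect residue field `k`, if `Δ ∈ 𝔪`, `c₄ ∉ 𝔪` and the node-tangent
polynomial of the reduction `Ī` has no root in `k`, then some `R`-model `J = D • I` has
`a₃ = a₄ = 0`, `a₆ ∈ 𝔪`, `b₂ ∈ Rˣ`, and `T² + ā₁T − ā₂` has no root in `k` (Silverman,
*ATAEC*, IV.9.4 Step 2: move the node to `(0, 0)`; the tangent form there is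
`T² + a₁T − a₂`). [cite: SilvermanATAEC1994, IV.9.4 Step 2] -/
theorem exists_smul_nonsplitNormalForm [HenselianLocalRing R] [PerfectField (ResidueField R)]
    (I : WeierstrassCurve R) (hΔ : I.Δ ∈ maximalIdeal R) (hc₄ : I.c₄ ∉ maximalIdeal R)
    (hns : ∀ μ : ResidueField R, (I.map (residue R)).c₄ * μ ^ 2 +
      (I.map (residue R)).a₁ * (I.map (residue R)).c₄ * μ -
        (54 * (I.map (residue R)).b₆ - 3 * (I.map (residue R)).b₂ * (I.map (residue R)).b₄ +
          (I.map (residue R)).a₂ * (I.map (residue R)).c₄) ≠ 0) :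
    ∃ D : WeierstrassCurve.VariableChange R,
      (D • I).a₃ = 0 ∧ (D • I).a₄ = 0 ∧ (D • I).a₆ ∈ maximalIdeal R ∧ IsUnit (D • I).b₂ ∧
        ∀ τ : ResidueField R, τ ^ 2 + residue R (D • I).a₁ * τ - residue R (D • I).a₂ ≠ 0 := by
  -- Step 2: node at the origin
  obtain ⟨C₂, hu₂, hA₃, hA₄, hA₆⟩ := exists_variableChange_step2_of_perfectField I hΔ
  set W₂ := C₂ • I with hW₂
  have hb₂ : IsUnit W₂.b₂ := by
    refine IsLocalRing.notMem_maximalIdeal.mp fun hmem => hc₄ ?_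
    have hc : I.c₄ = W₂.b₂ ^ 2 - 24 * (2 * W₂.a₄ + W₂.a₁ * W₂.a₃) := by
      have e : W₂.c₄ = I.c₄ := by rw [hW₂, WeierstrassCurve.variableChange_c₄, hu₂]; simp
      rw [← e]; rfl
    rw [hc]
    exact Ideal.sub_mem _ (Ideal.pow_mem_of_mem _ hmem 2 two_pos) (Ideal.mul_mem_left _ _
      (Ideal.add_mem _ (Ideal.mul_mem_left _ _ hA₄) (Ideal.mul_mem_left _ _ hA₃)))
  -- kill `a₃`, `a₄`
  obtain ⟨r, t, hr, ht, h3, h4⟩ := exists_rt_a₃_a₄_eq_zero W₂ hA₃ hA₄ hb₂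
  set C : WeierstrassCurve.VariableChange R := ⟨1, r, 0, t⟩ with hC
  refine ⟨C * C₂, ?_⟩
  rw [mul_smul]
  have h6 : (C • W₂).a₆ ∈ maximalIdeal R := by
    rw [WeierstrassCurve.variableChange_a₆, hC]
    simp only [inv_one, Units.val_one, one_pow, one_mul]
    refine Ideal.sub_mem _ (Ideal.sub_mem _ (Ideal.sub_mem _ (Ideal.add_mem _ (Ideal.add_mem _
      (Ideal.add_mem _ hA₆ (Ideal.mul_mem_right _ _ hr)) (Ideal.mul_mem_right _ _
      (Ideal.pow_mem_of_mem _ hr 2 two_pos))) (Ideal.pow_mem_of_mem _ hr 3 three_pos))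
      (Ideal.mul_mem_right _ _ ht)) (Ideal.pow_mem_of_mem _ ht 2 two_pos)) ?_
    exact Ideal.mul_mem_right _ _ (Ideal.mul_mem_right _ _ hr)
  have hb₂' : IsUnit (C • W₂).b₂ := by
    rw [WeierstrassCurve.variableChange_b₂, hC]
    simp only [inv_one, Units.val_one, one_pow, one_mul]
    obtain ⟨c, hc⟩ := (mem_maximalIdeal_iff_dvd_of_irreducible irreducible_uniformizer _).mp hr
    rw [hc, show W₂.b₂ + 12 * (uniformizer R * c) = W₂.b₂ + uniformizer R * (12 * c) by ring]
    exact isUnit_add_mul_of_isUnit irreducible_uniformizer hb₂ _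
  refine ⟨h3, h4, h6, hb₂', fun τ hτ => ?_⟩
  -- a root of the tangent form would be a root of the node-tangent polynomial of `Ī`
  set J := C • W₂ with hJ
  set Jb := J.map (residue R) with hJb
  have hJ3 : Jb.a₃ = 0 := by rw [hJb, WeierstrassCurve.map_a₃, h3, map_zero]
  have hJ4 : Jb.a₄ = 0 := by rw [hJb, WeierstrassCurve.map_a₄, h4, map_zero]
  have hJ6 : Jb.a₆ = 0 := by rw [hJb, WeierstrassCurve.map_a₆, (residue_eq_zero_iff _).mpr h6]
  have hτ' : τ ^ 2 + Jb.a₁ * τ - Jb.a₂ = 0 := by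
    rw [hJb, WeierstrassCurve.map_a₁, WeierstrassCurve.map_a₂]; exact hτ
  have hP := eval_nodePoly_of_a₃₄₆ Jb hJ3 hJ4 hJ6 τ
  rw [hτ', mul_zero] at hP
  -- `Jb = (C * C₂)‾ • Ī` with `u = 1`
  have hmap : Jb = ((C * C₂).map (residue R)) • I.map (residue R) := by
    rw [hJb, hJ, hW₂, ← mul_smul, WeierstrassCurve.map_variableChange]
  have hu : ((C * C₂).map (residue R)).u = 1 := by
    simp [WeierstrassCurve.VariableChange.map, WeierstrassCurve.VariableChange.mul_def, hC, hu₂]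
  rw [hmap, eval_nodePoly_smul _ _ hu] at hP
  exact hns _ hP

end LocalIndex

end Literature.NumberTheory.EllipticCurves

end
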